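import Mathlib
import HarnessLib
import Literature.Computability.AlgebraicComplexity.PatternExpressions
import Literature.Combinatorics.SimpleGraph.TreeDecomposition
import Summits.ValiantsHypothesis.ValiantsHypothesis.Theorems.MonotoneRestorationOrbitRestorationQPNarrowSpanAlgebra

/-!
# Core patterns: all-placements power sums of a LOCAL linear form are narrow with treewidth `≤ |core|`

Route MonotoneRestoration, crux `OrbitRestorationQP` (stmt-ValiantsHypothesis-18293), SPAN-currency lane of the open
sub-rung A_∞ (`stub_sigmaPiSigmaValue`); evidence note `SPAN-CURRENCY-A1-g7g4.md` §2 Step 5 (the ENGINE of the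
untwisted `ΠΣ` case).  Helper (`--supports`), def-free.  A LOCAL linear form with core `Fin r × Fin c` and datum
`(α, β, γ)` is, at the placement `φ, ψ`, `ℓ^{φ,ψ} = Σ_{a,b} α_{ab} x_{φ a, ψ b} + Σ_a β_a R_{φ a} + Σ_b γ_b C_{ψ b}`
(`R_p`, `C_q` the full row / column sums; cf. `LocalFactors.exists_rowColSupports_of_matrixSymmetric`).
* `homPoly_corePattern` — for lists `cells : Fin m₁ → R × C`, `rp : Fin m₂ → R`, `cp : Fin m₃ → C` the CORE PATTERN
  (core `R ⊔ C`, a fresh column vertex per row-pendant, a fresh row vertex per column-pendant) has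
  `hom = Σ_{φ,ψ} Π_i x_{φ(cells i).1, ψ(cells i).2} · Π_i R_{φ(rp i)} · Π_i C_{ψ(cp i)}` (ALL placements);
* `treewidth_corePattern_le` — its pattern graph has treewidth `≤ r + c` (path decomposition, bags core + one
  fresh vertex); `corePattern_mem_narrowSpan` — these sums are narrow generators (relabelled to `Fin`);
* `exists_lists_of_word` — kind separation of a word in the atoms `x_{ab}`, `R_a`, `C_b`;
* **`sum_placements_pow_localForm_mem_narrowSpan`** — THE ENGINE: `Σ_{φ,ψ} (ℓ^{φ,ψ})^k ∈ span_ℂ {hom_{F,n} : tw F ≤ r+c}`.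
Remaining for the untwisted `ΠΣ` case (note Steps 5–7): all placements → injective placements (induction on the
core) and Newton over the orbit (`NarrowSpanAlgebra.narrowSpan_mul_mem`).  No stub closed; VP ≠ VNP untouched.
-/

noncomputable section

-- `Summit.ValiantsHypothesis.ValiantsHypothesis.…` is the tree's single-conjunct layout (Sub = Summit).
set_option linter.dupNamespace false

namespace Summit.ValiantsHypothesis.ValiantsHypothesis.Theorems

namespace CorePatterns

open MvPolynomial Finset
open Literature.Computability.AlgebraicComplexity (homPoly)
open Literature.Combinatorics.SimpleGraph (treewidth treewidth_le_of_intervals treewidth_le_card_sub_one)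

universe u

/-- **Homomorphism polynomial of a core pattern** (all placements of the core; fresh pendant vertices summed
out independently). [cite: DwivediPagoSeppelt2026, eq. (1)] -/
theorem homPoly_corePattern (n r c m₁ m₂ m₃ : ℕ) (cells : Fin m₁ → Fin r × Fin c) (rp : Fin m₂ → Fin r)
    (cp : Fin m₃ → Fin c) :
    homPoly ((∑ i : Fin m₁, ({((Sum.inl (cells i).1 : Fin r ⊕ Fin m₃), (Sum.inl (cells i).2 : Fin c ⊕ Fin m₂))} :
        Multiset ((Fin r ⊕ Fin m₃) × (Fin c ⊕ Fin m₂)))) +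
      (∑ i : Fin m₂, ({((Sum.inl (rp i) : Fin r ⊕ Fin m₃), (Sum.inr i : Fin c ⊕ Fin m₂))} :
        Multiset ((Fin r ⊕ Fin m₃) × (Fin c ⊕ Fin m₂)))) +
      (∑ i : Fin m₃, ({((Sum.inr i : Fin r ⊕ Fin m₃), (Sum.inl (cp i) : Fin c ⊕ Fin m₂))} :
        Multiset ((Fin r ⊕ Fin m₃) × (Fin c ⊕ Fin m₂))))) n ℂ =
    ∑ φ : Fin r → Fin n, ∑ ψ : Fin c → Fin n,
      (∏ i : Fin m₁, (X (φ (cells i).1, ψ (cells i).2) : MvPolynomial (Fin n × Fin n) ℂ)) *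
      (∏ i : Fin m₂, ∑ j : Fin n, (X (φ (rp i), j) : MvPolynomial (Fin n × Fin n) ℂ)) *
      (∏ i : Fin m₃, ∑ j : Fin n, (X (j, ψ (cp i)) : MvPolynomial (Fin n × Fin n) ℂ)) := by
  unfold homPoly
  -- the product over the edge multiset, for a given vertex map `h`
  have hsing : ∀ {ι : Type} [Fintype ι] (e : ι → (Fin r ⊕ Fin m₃) × (Fin c ⊕ Fin m₂))
      (g : (Fin r ⊕ Fin m₃) × (Fin c ⊕ Fin m₂) → MvPolynomial (Fin n × Fin n) ℂ),
      ((∑ i, ({e i} : Multiset ((Fin r ⊕ Fin m₃) × (Fin c ⊕ Fin m₂)))).map g).prod = ∏ i, g (e i) := by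
    intro ι _ e g
    rw [show ((∑ i, ({e i} : Multiset ((Fin r ⊕ Fin m₃) × (Fin c ⊕ Fin m₂)))).map g) =
        ∑ i, (({e i} : Multiset _).map g) from map_sum (Multiset.mapAddMonoidHom g) _ _,
      Multiset.prod_sum]
    simp
  have hprod : ∀ h : (Fin r ⊕ Fin m₃ → Fin n) × (Fin c ⊕ Fin m₂ → Fin n),
      (((∑ i : Fin m₁, ({((Sum.inl (cells i).1 : Fin r ⊕ Fin m₃), (Sum.inl (cells i).2 : Fin c ⊕ Fin m₂))} :
          Multiset ((Fin r ⊕ Fin m₃) × (Fin c ⊕ Fin m₂)))) +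
        (∑ i : Fin m₂, ({((Sum.inl (rp i) : Fin r ⊕ Fin m₃), (Sum.inr i : Fin c ⊕ Fin m₂))} :
          Multiset ((Fin r ⊕ Fin m₃) × (Fin c ⊕ Fin m₂)))) +
        (∑ i : Fin m₃, ({((Sum.inr i : Fin r ⊕ Fin m₃), (Sum.inl (cp i) : Fin c ⊕ Fin m₂))} :
          Multiset ((Fin r ⊕ Fin m₃) × (Fin c ⊕ Fin m₂))))).map
        fun e => (X (h.1 e.1, h.2 e.2) : MvPolynomial (Fin n × Fin n) ℂ)).prod =
      (∏ i : Fin m₁, (X (h.1 (Sum.inl (cells i).1), h.2 (Sum.inl (cells i).2)) :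
          MvPolynomial (Fin n × Fin n) ℂ)) *
        (∏ i : Fin m₂, (X (h.1 (Sum.inl (rp i)), h.2 (Sum.inr i)) : MvPolynomial (Fin n × Fin n) ℂ)) *
        (∏ i : Fin m₃, (X (h.1 (Sum.inr i), h.2 (Sum.inl (cp i))) : MvPolynomial (Fin n × Fin n) ℂ)) := by
    intro h
    rw [Multiset.map_add, Multiset.map_add, Multiset.prod_add, Multiset.prod_add, hsing, hsing, hsing]
  simp_rw [hprod]
  -- split the vertex maps into core and fresh parts
  refine (Fintype.sum_equiv ((Equiv.sumArrowEquivProdArrow (Fin r) (Fin m₃) (Fin n)).prodCongr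
      (Equiv.sumArrowEquivProdArrow (Fin c) (Fin m₂) (Fin n))) _
    (fun p : ((Fin r → Fin n) × (Fin m₃ → Fin n)) × ((Fin c → Fin n) × (Fin m₂ → Fin n)) =>
      (∏ i : Fin m₁, (X (p.1.1 (cells i).1, p.2.1 (cells i).2) : MvPolynomial (Fin n × Fin n) ℂ)) *
        (∏ i : Fin m₂, (X (p.1.1 (rp i), p.2.2 i) : MvPolynomial (Fin n × Fin n) ℂ)) *
        (∏ i : Fin m₃, (X (p.1.2 i, p.2.1 (cp i)) : MvPolynomial (Fin n × Fin n) ℂ)))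
    (fun h => rfl)).trans ?_
  rw [Fintype.sum_prod_type, Fintype.sum_prod_type]
  refine Finset.sum_congr rfl fun φ _ => ?_
  simp_rw [Fintype.sum_prod_type]
  rw [Finset.sum_comm]
  refine Finset.sum_congr rfl fun ψ _ => ?_
  have hκ : ∀ ρ : Fin m₃ → Fin n,
      ∑ κ : Fin m₂ → Fin n,
        (∏ i : Fin m₁, (X (φ (cells i).1, ψ (cells i).2) : MvPolynomial (Fin n × Fin n) ℂ)) *
          (∏ i : Fin m₂, (X (φ (rp i), κ i) : MvPolynomial (Fin n × Fin n) ℂ)) *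
          (∏ i : Fin m₃, (X (ρ i, ψ (cp i)) : MvPolynomial (Fin n × Fin n) ℂ)) =
      (∏ i : Fin m₁, (X (φ (cells i).1, ψ (cells i).2) : MvPolynomial (Fin n × Fin n) ℂ)) *
        (∏ i : Fin m₂, ∑ j : Fin n, (X (φ (rp i), j) : MvPolynomial (Fin n × Fin n) ℂ)) *
        (∏ i : Fin m₃, (X (ρ i, ψ (cp i)) : MvPolynomial (Fin n × Fin n) ℂ)) := by
    intro ρ
    rw [Finset.prod_univ_sum]
    simp only [Fintype.piFinset_univ, Finset.mul_sum, Finset.sum_mul]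
  simp_rw [hκ]
  rw [← Finset.mul_sum]
  congr 1
  rw [Finset.prod_univ_sum]
  simp only [Fintype.piFinset_univ]

/-- **Core patterns have treewidth `≤ r + c`**: the bags "core + one fresh vertex" along a path (with a leading
bag "core") form a tree decomposition. [folklore] -/
theorem treewidth_corePattern_le (r c m₁ m₂ m₃ : ℕ) (cells : Fin m₁ → Fin r × Fin c) (rp : Fin m₂ → Fin r)
    (cp : Fin m₃ → Fin c) :
    treewidth (SimpleGraph.fromRel fun u v : (Fin r ⊕ Fin m₃) ⊕ (Fin c ⊕ Fin m₂) =>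
      ∃ e ∈ ((∑ i : Fin m₁, ({((Sum.inl (cells i).1 : Fin r ⊕ Fin m₃), (Sum.inl (cells i).2 : Fin c ⊕ Fin m₂))} :
          Multiset ((Fin r ⊕ Fin m₃) × (Fin c ⊕ Fin m₂)))) +
        (∑ i : Fin m₂, ({((Sum.inl (rp i) : Fin r ⊕ Fin m₃), (Sum.inr i : Fin c ⊕ Fin m₂))} :
          Multiset ((Fin r ⊕ Fin m₃) × (Fin c ⊕ Fin m₂)))) +
        (∑ i : Fin m₃, ({((Sum.inr i : Fin r ⊕ Fin m₃), (Sum.inl (cp i) : Fin c ⊕ Fin m₂))} :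
          Multiset ((Fin r ⊕ Fin m₃) × (Fin c ⊕ Fin m₂))))),
        u = Sum.inl e.1 ∧ v = Sum.inr e.2) ≤ r + c := by
  classical
  set E₀ : Multiset ((Fin r ⊕ Fin m₃) × (Fin c ⊕ Fin m₂)) :=
    (∑ i : Fin m₁, ({((Sum.inl (cells i).1 : Fin r ⊕ Fin m₃), (Sum.inl (cells i).2 : Fin c ⊕ Fin m₂))} :
        Multiset ((Fin r ⊕ Fin m₃) × (Fin c ⊕ Fin m₂)))) +
      (∑ i : Fin m₂, ({((Sum.inl (rp i) : Fin r ⊕ Fin m₃), (Sum.inr i : Fin c ⊕ Fin m₂))} :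
        Multiset ((Fin r ⊕ Fin m₃) × (Fin c ⊕ Fin m₂)))) +
      (∑ i : Fin m₃, ({((Sum.inr i : Fin r ⊕ Fin m₃), (Sum.inl (cp i) : Fin c ⊕ Fin m₂))} :
        Multiset ((Fin r ⊕ Fin m₃) × (Fin c ⊕ Fin m₂)))) with hE₀
  have memE₀ : ∀ e ∈ E₀, (∃ i, e = (Sum.inl (cells i).1, Sum.inl (cells i).2)) ∨
      (∃ i, e = (Sum.inl (rp i), Sum.inr i)) ∨ (∃ i, e = (Sum.inr i, Sum.inl (cp i))) := by
    intro e he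
    simp only [hE₀, Multiset.mem_add, Multiset.mem_sum, Finset.mem_univ, true_and,
      Multiset.mem_singleton] at he
    rcases he with (⟨i, hi⟩ | ⟨i, hi⟩) | ⟨i, hi⟩
    · exact Or.inl ⟨i, hi⟩
    · exact Or.inr (Or.inl ⟨i, hi⟩)
    · exact Or.inr (Or.inr ⟨i, hi⟩)
  -- the core, as a finset of vertices
  set core : Finset ((Fin r ⊕ Fin m₃) ⊕ (Fin c ⊕ Fin m₂)) :=
    (univ : Finset (Fin r)).map ⟨fun a => Sum.inl (Sum.inl a), fun a b h => by simpa using h⟩ ∪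
      (univ : Finset (Fin c)).map ⟨fun b => Sum.inr (Sum.inl b), fun a b h => by simpa using h⟩ with hcore
  have hcard_core : core.card ≤ r + c := by
    refine (Finset.card_union_le _ _).trans ?_
    simp [Finset.card_map]
  have mem_core_row : ∀ a : Fin r, (Sum.inl (Sum.inl a) : (Fin r ⊕ Fin m₃) ⊕ (Fin c ⊕ Fin m₂)) ∈ core := by
    intro a; simp [hcore]
  have mem_core_col : ∀ b : Fin c, (Sum.inr (Sum.inl b) : (Fin r ⊕ Fin m₃) ⊕ (Fin c ⊕ Fin m₂)) ∈ core := by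
    intro b; simp [hcore]
  have not_mem_core_fr : ∀ i : Fin m₃, (Sum.inl (Sum.inr i) : (Fin r ⊕ Fin m₃) ⊕ (Fin c ⊕ Fin m₂)) ∉ core := by
    intro i; simp [hcore]
  have not_mem_core_fc : ∀ i : Fin m₂, (Sum.inr (Sum.inr i) : (Fin r ⊕ Fin m₃) ⊕ (Fin c ⊕ Fin m₂)) ∉ core := by
    intro i; simp [hcore]
  -- the fresh vertices, enumerated by `Fin (m₂ + m₃)`
  set fresh : Fin (m₂ + m₃) → (Fin r ⊕ Fin m₃) ⊕ (Fin c ⊕ Fin m₂) :=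
    Fin.append (fun i : Fin m₂ => Sum.inr (Sum.inr i)) (fun i : Fin m₃ => Sum.inl (Sum.inr i)) with hfresh
  have fresh_left : ∀ i : Fin m₂, fresh (Fin.castAdd m₃ i) = Sum.inr (Sum.inr i) := by
    intro i; simp [hfresh]
  have fresh_right : ∀ i : Fin m₃, fresh (Fin.natAdd m₂ i) = Sum.inl (Sum.inr i) := by
    intro i; simp [hfresh]
  have fresh_inj : Function.Injective fresh := by
    intro s t hst
    induction s using Fin.addCases with
    | left s =>
      induction t using Fin.addCases with
      | left t => rw [fresh_left, fresh_left] at hst; simpa using hst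
      | right t => rw [fresh_left, fresh_right] at hst; simp at hst
    | right s =>
      induction t using Fin.addCases with
      | left t => rw [fresh_right, fresh_left] at hst; simp at hst
      | right t => rw [fresh_right, fresh_right] at hst; simpa using hst
  -- the bags: `B 0 = core`, `B (s+1) = core ∪ {fresh s}`
  set B : Fin (m₂ + m₃ + 1) → Finset ((Fin r ⊕ Fin m₃) ⊕ (Fin c ⊕ Fin m₂)) :=
    Fin.cons core (fun s => insert (fresh s) core) with hB
  have hB0 : B 0 = core := by simp [hB]
  have hBs : ∀ s, B s.succ = insert (fresh s) core := by intro s; simp [hB]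
  have core_sub : ∀ t, core ⊆ B t := by
    intro t
    induction t using Fin.cases with
    | zero => rw [hB0]
    | succ s => rw [hBs]; exact Finset.subset_insert _ _
  have mem_B_iff_of_not_core : ∀ {v}, v ∉ core → ∀ t, v ∈ B t ↔ ∃ s, t = s.succ ∧ v = fresh s := by
    intro v hv t
    induction t using Fin.cases with
    | zero =>
      rw [hB0]
      simp only [hv, false_iff, not_exists, not_and]
      intro s hs
      exact absurd hs (Fin.succ_ne_zero s).symm
    | succ s =>
      rw [hBs, Finset.mem_insert]
      constructor
      · rintro (h | h)
        · exact ⟨s, rfl, h⟩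
        · exact absurd h hv
      · rintro ⟨s', hs', rfl⟩
        exact Or.inl (by rw [Fin.succ_inj.1 hs'])
  refine treewidth_le_of_intervals _ B ?_ ?_ ?_ (fun t => ?_)
  · -- edges: `{inl e.1, inr e.2}` for `e ∈ E₀`
    have key : ∀ e ∈ E₀, ∃ t, (Sum.inl e.1 : (Fin r ⊕ Fin m₃) ⊕ (Fin c ⊕ Fin m₂)) ∈ B t ∧
        (Sum.inr e.2 : (Fin r ⊕ Fin m₃) ⊕ (Fin c ⊕ Fin m₂)) ∈ B t := by
      intro e he
      rcases memE₀ e he with ⟨i, rfl⟩ | ⟨i, rfl⟩ | ⟨i, rfl⟩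
      · exact ⟨0, core_sub 0 (mem_core_row _), core_sub 0 (mem_core_col _)⟩
      · refine ⟨(Fin.castAdd m₃ i).succ, core_sub _ (mem_core_row _), ?_⟩
        rw [hBs, Finset.mem_insert, fresh_left]
        exact Or.inl rfl
      · refine ⟨(Fin.natAdd m₂ i).succ, ?_, core_sub _ (mem_core_col _)⟩
        rw [hBs, Finset.mem_insert, fresh_right]
        exact Or.inl rfl
    intro u v huv
    rw [SimpleGraph.fromRel_adj] at huv
    obtain ⟨-, h⟩ := huv
    rcases h with ⟨e, he, rfl, rfl⟩ | ⟨e, he, rfl, rfl⟩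
    · exact key e he
    · obtain ⟨t, h1, h2⟩ := key e he
      exact ⟨t, h2, h1⟩
  · -- every vertex lies in a bag
    intro v
    by_cases hv : v ∈ core
    · exact ⟨0, core_sub 0 hv⟩
    · have : ∃ s, v = fresh s := by
        rcases v with ((a | i) | (b | i))
        · exact absurd (mem_core_row a) hv
        · exact ⟨Fin.natAdd m₂ i, (fresh_right i).symm⟩
        · exact absurd (mem_core_col b) hv
        · exact ⟨Fin.castAdd m₃ i, (fresh_left i).symm⟩
      obtain ⟨s, rfl⟩ := this
      exact ⟨s.succ, (mem_B_iff_of_not_core hv _).2 ⟨s, rfl, rfl⟩⟩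
  · -- intervals
    intro v
    by_cases hv : v ∈ core
    · have : {t | v ∈ B t} = Set.univ := Set.eq_univ_of_forall fun t => core_sub t hv
      rw [this]
      exact Set.ordConnected_univ
    · by_cases hex : ∃ s, v = fresh s
      · obtain ⟨s, rfl⟩ := hex
        have : {t | fresh s ∈ B t} = {s.succ} := by
          ext t
          rw [Set.mem_setOf_eq, mem_B_iff_of_not_core hv, Set.mem_singleton_iff]
          constructor
          · rintro ⟨s', rfl, h⟩
            rw [fresh_inj h]
          · rintro rfl
            exact ⟨s, rfl, rfl⟩
        rw [this]
        exact Set.ordConnected_singleton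
      · have : {t | v ∈ B t} = ∅ := by
          ext t
          simp only [Set.mem_setOf_eq, Set.mem_empty_iff_false, iff_false, mem_B_iff_of_not_core hv]
          rintro ⟨s, -, hs⟩
          exact hex ⟨s, hs⟩
        rw [this]
        exact Set.ordConnected_empty
  · -- bag sizes
    induction t using Fin.cases with
    | zero => rw [hB0]; omega
    | succ s => rw [hBs]; exact (Finset.card_insert_le _ _).trans (by omega)

/-- **Core-pattern sums are narrow generators of treewidth `≤ r + c`** (relabelled to `Fin (r + m₃) × Fin (c + m₂)`).
[folklore] -/
theorem corePattern_mem_narrowSpan (n r c m₁ m₂ m₃ : ℕ) (cells : Fin m₁ → Fin r × Fin c) (rp : Fin m₂ → Fin r)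
    (cp : Fin m₃ → Fin c) :
    (∑ φ : Fin r → Fin n, ∑ ψ : Fin c → Fin n,
      (∏ i : Fin m₁, (X (φ (cells i).1, ψ (cells i).2) : MvPolynomial (Fin n × Fin n) ℂ)) *
      (∏ i : Fin m₂, ∑ j : Fin n, (X (φ (rp i), j) : MvPolynomial (Fin n × Fin n) ℂ)) *
      (∏ i : Fin m₃, ∑ j : Fin n, (X (j, ψ (cp i)) : MvPolynomial (Fin n × Fin n) ℂ))) ∈
    Submodule.span ℂ {p : MvPolynomial (Fin n × Fin n) ℂ |
        ∃ (a b : ℕ) (E : Multiset (Fin a × Fin b)),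
          treewidth (SimpleGraph.fromRel fun u v : Fin a ⊕ Fin b =>
            ∃ e ∈ E, u = Sum.inl e.1 ∧ v = Sum.inr e.2) ≤ r + c ∧ p = homPoly E n ℂ} := by
  set E₀ : Multiset ((Fin r ⊕ Fin m₃) × (Fin c ⊕ Fin m₂)) :=
    (∑ i : Fin m₁, ({((Sum.inl (cells i).1 : Fin r ⊕ Fin m₃), (Sum.inl (cells i).2 : Fin c ⊕ Fin m₂))} :
        Multiset ((Fin r ⊕ Fin m₃) × (Fin c ⊕ Fin m₂)))) +
      (∑ i : Fin m₂, ({((Sum.inl (rp i) : Fin r ⊕ Fin m₃), (Sum.inr i : Fin c ⊕ Fin m₂))} :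
        Multiset ((Fin r ⊕ Fin m₃) × (Fin c ⊕ Fin m₂)))) +
      (∑ i : Fin m₃, ({((Sum.inr i : Fin r ⊕ Fin m₃), (Sum.inl (cp i) : Fin c ⊕ Fin m₂))} :
        Multiset ((Fin r ⊕ Fin m₃) × (Fin c ⊕ Fin m₂)))) with hE₀
  refine Submodule.subset_span ⟨r + m₃, c + m₂, E₀.map fun e => (finSumFinEquiv e.1, finSumFinEquiv e.2), ?_, ?_⟩
  · refine (NarrowSpanAlgebra.treewidth_patternGraph_map_equiv_le E₀ finSumFinEquiv finSumFinEquiv).trans ?_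
    rw [hE₀]
    exact treewidth_corePattern_le r c m₁ m₂ m₃ cells rp cp
  · rw [HomPolyBasics.homPoly_map_equiv, hE₀, homPoly_corePattern]

/-- **Kind separation.**  A word in the atoms `x_{ab}` (`inl (a,b)`), `R_a` (`inr (inl a)`), `C_b` (`inr (inr b)`)
evaluates, at every placement and uniformly, to a core-pattern triple product. [folklore] -/
theorem exists_lists_of_word (r c : ℕ) :
    ∀ (k : ℕ) (w : Fin k → (Fin r × Fin c) ⊕ (Fin r ⊕ Fin c)),
      ∃ (m₁ : ℕ) (cells : Fin m₁ → Fin r × Fin c) (m₂ : ℕ) (rp : Fin m₂ → Fin r) (m₃ : ℕ) (cp : Fin m₃ → Fin c),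
        ∀ (n : ℕ) (φ : Fin r → Fin n) (ψ : Fin c → Fin n),
          (∏ i : Fin k, (Sum.elim (fun ab : Fin r × Fin c => (X (φ ab.1, ψ ab.2) : MvPolynomial (Fin n × Fin n) ℂ))
              (Sum.elim (fun a : Fin r => ∑ j : Fin n, (X (φ a, j) : MvPolynomial (Fin n × Fin n) ℂ))
                (fun b : Fin c => ∑ j : Fin n, (X (j, ψ b) : MvPolynomial (Fin n × Fin n) ℂ))) (w i)) : _) =
          (∏ i : Fin m₁, (X (φ (cells i).1, ψ (cells i).2) : MvPolynomial (Fin n × Fin n) ℂ)) *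
            (∏ i : Fin m₂, ∑ j : Fin n, (X (φ (rp i), j) : MvPolynomial (Fin n × Fin n) ℂ)) *
            (∏ i : Fin m₃, ∑ j : Fin n, (X (j, ψ (cp i)) : MvPolynomial (Fin n × Fin n) ℂ)) := by
  intro k
  induction k with
  | zero =>
    intro w
    exact ⟨0, Fin.elim0, 0, Fin.elim0, 0, Fin.elim0, fun n φ ψ => by simp⟩
  | succ k ih =>
    intro w
    obtain ⟨m₁, cells, m₂, rp, m₃, cp, h⟩ := ih (Fin.tail w)
    rcases hw : w 0 with ⟨a, b⟩ | (a | b)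
    · refine ⟨m₁ + 1, Fin.cons (a, b) cells, m₂, rp, m₃, cp, fun n φ ψ => ?_⟩
      rw [Fin.prod_univ_succ, hw, Fin.prod_univ_succ]
      simp only [Sum.elim_inl, Fin.cons_zero, Fin.cons_succ]
      rw [show (∏ i : Fin k, (Sum.elim (fun ab : Fin r × Fin c => (X (φ ab.1, ψ ab.2) : MvPolynomial (Fin n × Fin n) ℂ))
              (Sum.elim (fun a : Fin r => ∑ j : Fin n, (X (φ a, j) : MvPolynomial (Fin n × Fin n) ℂ))
                (fun b : Fin c => ∑ j : Fin n, (X (j, ψ b) : MvPolynomial (Fin n × Fin n) ℂ))) (w i.succ)) : _) = _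
        from h n φ ψ]
      ring
    · refine ⟨m₁, cells, m₂ + 1, Fin.cons a rp, m₃, cp, fun n φ ψ => ?_⟩
      rw [Fin.prod_univ_succ, hw, Fin.prod_univ_succ (n := m₂)]
      simp only [Sum.elim_inr, Sum.elim_inl, Fin.cons_zero, Fin.cons_succ]
      rw [show (∏ i : Fin k, (Sum.elim (fun ab : Fin r × Fin c => (X (φ ab.1, ψ ab.2) : MvPolynomial (Fin n × Fin n) ℂ))
              (Sum.elim (fun a : Fin r => ∑ j : Fin n, (X (φ a, j) : MvPolynomial (Fin n × Fin n) ℂ))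
                (fun b : Fin c => ∑ j : Fin n, (X (j, ψ b) : MvPolynomial (Fin n × Fin n) ℂ))) (w i.succ)) : _) = _
        from h n φ ψ]
      ring
    · refine ⟨m₁, cells, m₂, rp, m₃ + 1, Fin.cons b cp, fun n φ ψ => ?_⟩
      rw [Fin.prod_univ_succ, hw, Fin.prod_univ_succ (n := m₃)]
      simp only [Sum.elim_inr, Fin.cons_zero, Fin.cons_succ]
      rw [show (∏ i : Fin k, (Sum.elim (fun ab : Fin r × Fin c => (X (φ ab.1, ψ ab.2) : MvPolynomial (Fin n × Fin n) ℂ))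
              (Sum.elim (fun a : Fin r => ∑ j : Fin n, (X (φ a, j) : MvPolynomial (Fin n × Fin n) ℂ))
                (fun b : Fin c => ∑ j : Fin n, (X (j, ψ b) : MvPolynomial (Fin n × Fin n) ℂ))) (w i.succ)) : _) = _
        from h n φ ψ]
      ring

/-- **All-placements power sums of a LOCAL linear form are narrow, treewidth `≤ |core|`.**  For every coefficient
datum `α : R × C → ℂ`, `β : R → ℂ`, `γ : C → ℂ` on the core `R = Fin r`, `C = Fin c`, and every `k`,
`Σ_{φ : R → [n], ψ : C → [n]} (Σ_{ab} α_{ab} x_{φ a, ψ b} + Σ_a β_a R_{φ a} + Σ_b γ_b C_{ψ b})^k`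
lies in `span_ℂ {hom_{F,n} : tw F ≤ r + c}`. [folklore; cite: DwivediPagoSeppelt2026, §8] -/
theorem sum_placements_pow_localForm_mem_narrowSpan (n r c k : ℕ) (α : Fin r × Fin c → ℂ) (β : Fin r → ℂ)
    (γ : Fin c → ℂ) :
    (∑ φ : Fin r → Fin n, ∑ ψ : Fin c → Fin n,
      ((∑ ab : Fin r × Fin c, C (α ab) * (X (φ ab.1, ψ ab.2) : MvPolynomial (Fin n × Fin n) ℂ)) +
        (∑ a : Fin r, C (β a) * ∑ j : Fin n, (X (φ a, j) : MvPolynomial (Fin n × Fin n) ℂ)) +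
        (∑ b : Fin c, C (γ b) * ∑ j : Fin n, (X (j, ψ b) : MvPolynomial (Fin n × Fin n) ℂ))) ^ k) ∈
    Submodule.span ℂ {p : MvPolynomial (Fin n × Fin n) ℂ |
        ∃ (a b : ℕ) (E : Multiset (Fin a × Fin b)),
          treewidth (SimpleGraph.fromRel fun u v : Fin a ⊕ Fin b =>
            ∃ e ∈ E, u = Sum.inl e.1 ∧ v = Sum.inr e.2) ≤ r + c ∧ p = homPoly E n ℂ} := by
  -- the form as ONE sum over the atom type `S = (R × C) ⊕ (R ⊕ C)`
  set coef : (Fin r × Fin c) ⊕ (Fin r ⊕ Fin c) → ℂ := Sum.elim α (Sum.elim β γ) with hcoef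
  have hform : ∀ (φ : Fin r → Fin n) (ψ : Fin c → Fin n),
      ((∑ ab : Fin r × Fin c, C (α ab) * (X (φ ab.1, ψ ab.2) : MvPolynomial (Fin n × Fin n) ℂ)) +
        (∑ a : Fin r, C (β a) * ∑ j : Fin n, (X (φ a, j) : MvPolynomial (Fin n × Fin n) ℂ)) +
        (∑ b : Fin c, C (γ b) * ∑ j : Fin n, (X (j, ψ b) : MvPolynomial (Fin n × Fin n) ℂ))) =
      ∑ s : (Fin r × Fin c) ⊕ (Fin r ⊕ Fin c), C (coef s) *
        (Sum.elim (fun ab : Fin r × Fin c => (X (φ ab.1, ψ ab.2) : MvPolynomial (Fin n × Fin n) ℂ))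
          (Sum.elim (fun a : Fin r => ∑ j : Fin n, (X (φ a, j) : MvPolynomial (Fin n × Fin n) ℂ))
            (fun b : Fin c => ∑ j : Fin n, (X (j, ψ b) : MvPolynomial (Fin n × Fin n) ℂ))) s) := by
    intro φ ψ
    simp only [Fintype.sum_sum_type, hcoef, Sum.elim_inl, Sum.elim_inr, add_assoc]
  simp_rw [hform]
  -- expand the power over words
  have hpow : ∀ (φ : Fin r → Fin n) (ψ : Fin c → Fin n),
      (∑ s : (Fin r × Fin c) ⊕ (Fin r ⊕ Fin c), C (coef s) *
        (Sum.elim (fun ab : Fin r × Fin c => (X (φ ab.1, ψ ab.2) : MvPolynomial (Fin n × Fin n) ℂ))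
          (Sum.elim (fun a : Fin r => ∑ j : Fin n, (X (φ a, j) : MvPolynomial (Fin n × Fin n) ℂ))
            (fun b : Fin c => ∑ j : Fin n, (X (j, ψ b) : MvPolynomial (Fin n × Fin n) ℂ))) s)) ^ k =
      ∑ w : Fin k → (Fin r × Fin c) ⊕ (Fin r ⊕ Fin c), (C (∏ i, coef (w i)) : MvPolynomial (Fin n × Fin n) ℂ) *
        ∏ i : Fin k, (Sum.elim (fun ab : Fin r × Fin c => (X (φ ab.1, ψ ab.2) : MvPolynomial (Fin n × Fin n) ℂ))
          (Sum.elim (fun a : Fin r => ∑ j : Fin n, (X (φ a, j) : MvPolynomial (Fin n × Fin n) ℂ))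
            (fun b : Fin c => ∑ j : Fin n, (X (j, ψ b) : MvPolynomial (Fin n × Fin n) ℂ))) (w i)) := by
    intro φ ψ
    rw [show (∑ s : (Fin r × Fin c) ⊕ (Fin r ⊕ Fin c), C (coef s) *
        (Sum.elim (fun ab : Fin r × Fin c => (X (φ ab.1, ψ ab.2) : MvPolynomial (Fin n × Fin n) ℂ))
          (Sum.elim (fun a : Fin r => ∑ j : Fin n, (X (φ a, j) : MvPolynomial (Fin n × Fin n) ℂ))
            (fun b : Fin c => ∑ j : Fin n, (X (j, ψ b) : MvPolynomial (Fin n × Fin n) ℂ))) s)) ^ k =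
        ∏ i : Fin k, ∑ s ∈ (fun _ => (univ : Finset ((Fin r × Fin c) ⊕ (Fin r ⊕ Fin c)))) i, C (coef s) *
        (Sum.elim (fun ab : Fin r × Fin c => (X (φ ab.1, ψ ab.2) : MvPolynomial (Fin n × Fin n) ℂ))
          (Sum.elim (fun a : Fin r => ∑ j : Fin n, (X (φ a, j) : MvPolynomial (Fin n × Fin n) ℂ))
            (fun b : Fin c => ∑ j : Fin n, (X (j, ψ b) : MvPolynomial (Fin n × Fin n) ℂ))) s) from by simp,
      Finset.prod_univ_sum]
    simp only [Fintype.piFinset_univ]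
    refine Finset.sum_congr rfl fun w _ => ?_
    rw [Finset.prod_mul_distrib, map_prod]
  simp_rw [hpow]
  simp_rw [Finset.sum_comm (γ := Fin c → Fin n)]
  rw [Finset.sum_comm]
  refine Submodule.sum_mem _ fun w _ => ?_
  simp_rw [← Finset.mul_sum]
  obtain ⟨m₁, cells, m₂, rp, m₃, cp, h⟩ := exists_lists_of_word r c k w
  simp_rw [h n]
  rw [← MvPolynomial.smul_eq_C_mul]
  exact Submodule.smul_mem _ _ (corePattern_mem_narrowSpan n r c m₁ m₂ m₃ cells rp cp)

end CorePatterns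

end Summit.ValiantsHypothesis.ValiantsHypothesis.Theorems

end
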